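import Literature.Analysis.Calculus.SpherePoincareSharp
import Mathlib.MeasureTheory.Function.L2Space
import HarnessLib

/-!
# The sharp Poincaré inequality on spheres for vector-valued functions, any radius

Analysis support file (everything proved; no definitions, no named facts) for the `S³` spectral
input of A. Waldron, Invent. math. 217 (2019), Lemma 3.5(a) in the `u = ⋆(x ∧ F)` formalism:
from the scalar inequality `Literature.Analysis.Calculus.MvPoly.sharp_poincare_sphere`
(`(n−1)(∮f² − (∮f)²/∮1) ≤ ½∑ᵢⱼ∮(∂_{L_{ij}}f)²` on the unit sphere of `ℝⁿ`) we derive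

* `sphereIntegral_comp_smul`, `angDeriv_comp_smul` — scaling to radius `r`;
* `sharp_poincare_sphere_radius` — the scalar inequality on `S_r`;
* `sharp_poincare_sphere_vector` — for `v : ℝⁿ → V` (`V` a finite-dimensional inner product
  space), `C²` off the origin, and `r > 0`:
  `(n−1)(∮_{S_r}‖v‖² − ‖∮_{S_r} v‖²/∮1) ≤ ½∑ᵢⱼ ∮_{S_r} ‖Dv(x)(L_{ij}x)‖²` (Parseval in an
  orthonormal basis of `V`).

References: A. Waldron, Invent. math. 217 (2019), Lemma 3.5 [Waldron2019]; [folklore].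
-/

noncomputable section

open scoped BigOperators RealInnerProductSpace
open MeasureTheory Metric Set
open Literature.Analysis.FluidPDE Literature.Analysis.Calculus

namespace Literature.Analysis.Calculus.MvPoly

variable {n : ℕ}

local notation "𝔼" => EuclideanSpace ℝ (Fin n)
local notation "𝕓" => EuclideanSpace.basisFun (Fin n) ℝ

section Scaling

variable {F : Type*} [NormedAddCommGroup F] [NormedSpace ℝ F]

/-- **Scaling of sphere integrals**: `∮_{S_r} f = ∮_{S_1} f(r ·)`. [folklore] -/
theorem sphereIntegral_comp_smul (f : 𝔼 → F) (r : ℝ) :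
    sphereIntegral (volume : Measure 𝔼) f r =
      sphereIntegral (volume : Measure 𝔼) (fun x => f (r • x)) 1 := by
  simp only [sphereIntegral_def, one_smul]

/-- **Angular derivatives commute with dilations**: `∂_{L}(f ∘ (r·))(x) = (∂_L f)(r x)` for `f`
differentiable at `r x`. [folklore] -/
theorem fderiv_comp_smul_angularField {f : 𝔼 → F} {r : ℝ} {x : 𝔼}
    (hf : DifferentiableAt ℝ f (r • x)) (i j : Fin n) :
    fderiv ℝ (fun y => f (r • y)) x (angularField 𝕓 i j x) =
      fderiv ℝ f (r • x) (angularField 𝕓 i j (r • x)) := by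
  have h : HasFDerivAt (fun y : 𝔼 => f (r • y)) ((fderiv ℝ f (r • x)).comp (r • ContinuousLinearMap.id ℝ 𝔼)) x := by
    have h1 : HasFDerivAt (fun y : 𝔼 => r • y) (r • ContinuousLinearMap.id ℝ 𝔼) x :=
      (ContinuousLinearMap.id ℝ 𝔼).hasFDerivAt.const_smul r
    exact hf.hasFDerivAt.comp x h1
  rw [h.fderiv]
  simp only [ContinuousLinearMap.comp_apply, FunLike.coe_smul, Pi.smul_apply,
    ContinuousLinearMap.id_apply]
  congr 1
  rw [angularField_apply, angularField_apply]
  simp only [inner_smul_left, RCLike.conj_to_real, smul_sub, smul_smul]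

end Scaling

section Radius

/-- `x ↦ r • x` maps `{0}ᶜ` to `{0}ᶜ` for `r ≠ 0`. [folklore] -/
theorem mapsTo_smul_compl_zero {r : ℝ} (hr : r ≠ 0) :
    MapsTo (fun x : 𝔼 => r • x) ({0}ᶜ : Set 𝔼) {0}ᶜ := fun x hx => by
  simp only [mem_compl_iff, mem_singleton_iff, smul_eq_zero, not_or] at hx ⊢
  exact ⟨hr, hx⟩

/-- **The sharp Poincaré inequality on `S_r`** (scalar): for `f ∈ C²` off the origin and `r > 0`,
`(n−1)(∮_{S_r} f² − (∮_{S_r} f)²/∮1) ≤ ½∑ᵢⱼ ∮_{S_r} (Df(x)(L_{ij}x))²`. [folklore] -/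
theorem sharp_poincare_sphere_radius (hn : 2 ≤ n) {f : 𝔼 → ℝ} (hf : ContDiffOn ℝ 2 f {0}ᶜ)
    {r : ℝ} (hr : 0 < r) :
    ((n : ℝ) - 1) * (sphereIntegral (volume : Measure 𝔼) (fun x => f x ^ 2) r -
        (sphereIntegral (volume : Measure 𝔼) f r) ^ 2 /
          sphereIntegral (volume : Measure 𝔼) (fun _ => (1 : ℝ)) r) ≤
      (1 / 2) * ∑ i, ∑ j, sphereIntegral (volume : Measure 𝔼)
        (fun x => (fderiv ℝ f x (angularField 𝕓 i j x)) ^ 2) r := by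
  set g : 𝔼 → ℝ := fun x => f (r • x) with hg
  have hgs : ContDiffOn ℝ 2 g {0}ᶜ :=
    hf.comp (contDiff_const_smul r).contDiffOn (mapsTo_smul_compl_zero hr.ne')
  have h := sharp_poincare_sphere hn hgs
  have h1 : sphereIntegral (volume : Measure 𝔼) (fun x => g x ^ 2) 1 =
      sphereIntegral (volume : Measure 𝔼) (fun x => f x ^ 2) r :=
    (sphereIntegral_comp_smul (fun x => f x ^ 2) r).symm
  have h2 : sphereIntegral (volume : Measure 𝔼) g 1 = sphereIntegral (volume : Measure 𝔼) f r :=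
    (sphereIntegral_comp_smul f r).symm
  have h3 : sphereIntegral (volume : Measure 𝔼) (fun _ => (1 : ℝ)) 1 =
      sphereIntegral (volume : Measure 𝔼) (fun _ => (1 : ℝ)) r :=
    (sphereIntegral_comp_smul (fun _ => (1 : ℝ)) r).symm
  have h4 : sphDirichlet 𝕓 g g 1 = (1 / 2) * ∑ i, ∑ j, sphereIntegral (volume : Measure 𝔼)
      (fun x => (fderiv ℝ f x (angularField 𝕓 i j x)) ^ 2) r := by
    unfold sphDirichlet
    congr 1
    refine Finset.sum_congr rfl fun i _ => Finset.sum_congr rfl fun j _ => ?_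
    rw [sphereIntegral_comp_smul (fun x => (fderiv ℝ f x (angularField 𝕓 i j x)) ^ 2) r]
    refine sphereIntegral_congr_norm zero_le_one fun x hx => ?_
    have hx0 : r • x ∈ ({0}ᶜ : Set 𝔼) := by
      have : x ≠ 0 := fun h0 => by rw [h0, norm_zero] at hx; norm_num at hx
      exact mapsTo_smul_compl_zero hr.ne' (mem_compl_singleton_iff.2 this)
    have hfd : DifferentiableAt ℝ f (r • x) :=
      (hf.differentiableOn (by norm_num)).differentiableAt (isOpen_compl_singleton.mem_nhds hx0)
    simp only [angDeriv, hg]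
    rw [fderiv_comp_smul_angularField hfd, sq]
  rw [h1, h2, h3, h4] at h
  exact h

end Radius

section Vector

variable {V : Type*} [NormedAddCommGroup V] [InnerProductSpace ℝ V] [FiniteDimensional ℝ V]

omit [InnerProductSpace ℝ V] [FiniteDimensional ℝ V] in
/-- Integrability on the dilated unit sphere of a vector-valued function continuous off the
origin. [folklore] -/
theorem integrable_toSphere_of_continuousOn_vec [NormedSpace ℝ V] {v : 𝔼 → V} (hv : ContinuousOn v {0}ᶜ) {r : ℝ}
    (hr : 0 < r) :
    Integrable (fun θ : sphere (0 : 𝔼) 1 => v (r • (θ : 𝔼))) (volume : Measure 𝔼).toSphere := by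
  have hcont : Continuous fun θ : sphere (0 : 𝔼) 1 => v (r • (θ : 𝔼)) := by
    refine hv.comp_continuous ((continuous_const (y := r)).smul continuous_subtype_val) fun θ => ?_
    simp only [mem_compl_iff, mem_singleton_iff, smul_eq_zero, not_or]
    exact ⟨hr.ne', ne_zero_of_mem_unit_sphere θ⟩
  exact hcont.integrable_of_hasCompactSupport (HasCompactSupport.of_compactSpace _)

/-- Components of the mean: `∮ ⟨v, c⟩ = ⟨∮ v, c⟩`. [folklore] -/
theorem sphereIntegral_inner_const {v : 𝔼 → V} (hv : ContinuousOn v {0}ᶜ) {r : ℝ} (hr : 0 < r)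
    (c : V) :
    sphereIntegral (volume : Measure 𝔼) (fun x => ⟪v x, c⟫) r =
      ⟪sphereIntegral (volume : Measure 𝔼) v r, c⟫ := by
  rw [sphereIntegral_def, sphereIntegral_def, real_inner_comm,
    ← integral_inner (integrable_toSphere_of_continuousOn_vec hv hr) c]
  exact integral_congr_ae (ae_of_all _ fun θ => real_inner_comm _ _)

/-- **The sharp Poincaré inequality on `S_r` for vector-valued functions**: for
`v : ℝⁿ → V` of class `C²` off the origin (`V` a finite-dimensional inner product space) and
`r > 0`, `(n−1)(∮_{S_r}‖v‖² − ‖∮_{S_r}v‖²/∮1) ≤ ½∑ᵢⱼ ∮_{S_r} ‖Dv(x)(L_{ij}x)‖²`.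
[folklore] -/
theorem sharp_poincare_sphere_vector (hn : 2 ≤ n) {v : 𝔼 → V} (hv : ContDiffOn ℝ 2 v {0}ᶜ)
    {r : ℝ} (hr : 0 < r) :
    ((n : ℝ) - 1) * (sphereIntegral (volume : Measure 𝔼) (fun x => ‖v x‖ ^ 2) r -
        ‖sphereIntegral (volume : Measure 𝔼) v r‖ ^ 2 /
          sphereIntegral (volume : Measure 𝔼) (fun _ => (1 : ℝ)) r) ≤
      (1 / 2) * ∑ i, ∑ j, sphereIntegral (volume : Measure 𝔼)
        (fun x => ‖fderiv ℝ v x (angularField 𝕓 i j x)‖ ^ 2) r := by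
  set e := stdOrthonormalBasis ℝ V with he
  have hO : IsOpen ({0}ᶜ : Set 𝔼) := isOpen_compl_singleton
  have hvc : ContinuousOn v {0}ᶜ := hv.continuousOn
  have hvd : ∀ x ∈ ({0}ᶜ : Set 𝔼), DifferentiableAt ℝ v x := fun x hx =>
    (hv.differentiableOn (by norm_num)).differentiableAt (hO.mem_nhds hx)
  -- the scalar components
  set f : Fin (Module.finrank ℝ V) → 𝔼 → ℝ := fun k x => ⟪v x, e k⟫ with hf
  have hfk : ∀ k, ContDiffOn ℝ 2 (f k) {0}ᶜ := fun k => hv.inner ℝ contDiffOn_const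
  have hfc : ∀ k, ContinuousOn (f k) {0}ᶜ := fun k => (hfk k).continuousOn
  have hk := fun k => sharp_poincare_sphere_radius hn (hfk k) hr
  -- Parseval, pointwise and for the mean
  have hP1 : ∀ x, ‖v x‖ ^ 2 = ∑ k, f k x ^ 2 := fun x => (e.sum_sq_inner_left (v x)).symm
  have hP2 : ‖sphereIntegral (volume : Measure 𝔼) v r‖ ^ 2 =
      ∑ k, (sphereIntegral (volume : Measure 𝔼) (f k) r) ^ 2 := by
    rw [← e.sum_sq_inner_left]
    refine Finset.sum_congr rfl fun k _ => ?_
    rw [sphereIntegral_inner_const hvc hr]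
  have hP3 : ∀ i j, ∀ x, ‖x‖ = r → ‖fderiv ℝ v x (angularField 𝕓 i j x)‖ ^ 2 =
      ∑ k, (fderiv ℝ (f k) x (angularField 𝕓 i j x)) ^ 2 := by
    intro i j x hx
    have hx0 : x ∈ ({0}ᶜ : Set 𝔼) := by
      have : x ≠ 0 := fun h0 => by rw [h0, norm_zero] at hx; exact hr.ne' hx.symm
      exact mem_compl_singleton_iff.2 this
    rw [← e.sum_sq_inner_left]
    refine Finset.sum_congr rfl fun k _ => ?_
    rw [fderiv_inner_apply ℝ (hvd x hx0) (differentiableAt_const (e k))]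
    simp [fderiv_fun_const]
  -- rewrite every term as a sum over `k` and add up the scalar inequalities
  have hL1 : sphereIntegral (volume : Measure 𝔼) (fun x => ‖v x‖ ^ 2) r =
      ∑ k, sphereIntegral (volume : Measure 𝔼) (fun x => f k x ^ 2) r := by
    rw [← sphereIntegral_finset_sum Finset.univ (g := fun k x => f k x ^ 2)
      (fun k _ => (hfc k).pow 2) hr]
    exact sphereIntegral_congr_norm hr.le fun x _ => hP1 x
  have hR : ∀ i j, sphereIntegral (volume : Measure 𝔼)
      (fun x => ‖fderiv ℝ v x (angularField 𝕓 i j x)‖ ^ 2) r =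
      ∑ k, sphereIntegral (volume : Measure 𝔼)
        (fun x => (fderiv ℝ (f k) x (angularField 𝕓 i j x)) ^ 2) r := by
    intro i j
    have hck : ∀ k, ContinuousOn (fun x => (fderiv ℝ (f k) x (angularField 𝕓 i j x)) ^ 2) {0}ᶜ :=
      fun k => (((hfk k).continuousOn_fderiv_of_isOpen hO (by norm_num)).clm_apply
        (continuous_angularField 𝕓 i j).continuousOn).pow 2
    rw [← sphereIntegral_finset_sum Finset.univ
      (g := fun k x => (fderiv ℝ (f k) x (angularField 𝕓 i j x)) ^ 2) (fun k _ => hck k) hr]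
    exact sphereIntegral_congr_norm hr.le fun x hx => hP3 i j x hx
  rw [hL1, hP2]
  simp_rw [hR]
  have hsum := Finset.sum_le_sum fun k (_ : k ∈ Finset.univ) => hk k
  calc ((n : ℝ) - 1) * (∑ k, sphereIntegral (volume : Measure 𝔼) (fun x => f k x ^ 2) r -
        (∑ k, (sphereIntegral (volume : Measure 𝔼) (f k) r) ^ 2) /
          sphereIntegral (volume : Measure 𝔼) (fun _ => (1 : ℝ)) r)
      = ∑ k, ((n : ℝ) - 1) * (sphereIntegral (volume : Measure 𝔼) (fun x => f k x ^ 2) r -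
          (sphereIntegral (volume : Measure 𝔼) (f k) r) ^ 2 /
            sphereIntegral (volume : Measure 𝔼) (fun _ => (1 : ℝ)) r) := by
        rw [Finset.sum_div, ← Finset.sum_sub_distrib, Finset.mul_sum]
    _ ≤ ∑ k, (1 / 2) * ∑ i, ∑ j, sphereIntegral (volume : Measure 𝔼)
          (fun x => (fderiv ℝ (f k) x (angularField 𝕓 i j x)) ^ 2) r := hsum
    _ = (1 / 2) * ∑ i, ∑ j, ∑ k, sphereIntegral (volume : Measure 𝔼)
          (fun x => (fderiv ℝ (f k) x (angularField 𝕓 i j x)) ^ 2) r := by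
        rw [← Finset.mul_sum]
        congr 1
        rw [Finset.sum_comm]
        refine Finset.sum_congr rfl fun i _ => ?_
        rw [Finset.sum_comm]

end Vector

end Literature.Analysis.Calculus.MvPoly
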